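import Summits.Parity.GeneralizedHardyLittlewood.Theorems.DicksonFibrationDimOneReduction
import Summits.Parity.GeneralizedHardyLittlewood.Theorems.PairsToGHL.Negative.UnboundedSiegelZeros
import HarnessLib

/-!
# Route `DicksonFibration`, crux `DimOne` (stmt-Parity-0819), line `birth` (sieve model), part 2:
# `TwoFlatFactors ↔ DimOne`

Lead `prover-line-stmt-Parity-0819-c2-0`, 2026-08-17. Continuation of `…DicksonFibrationDimOneReduction.lean`
(interval bookkeeping, `corrTerm_empty_eq`, `corrTerm_singleton_eq`, `sharpMainTerm_of`, `oneFlatFactor_of`).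
Here: the multilinear expansion `vonMangoldtSum = Σ_T corrTerm T` (`vonMangoldtSum_eq_sum_corrTerm`,
`sum_powerset_split`), the three-piece composition `dimOne_of_three`, the now UNCONDITIONAL pieces
`sharpMainTerm : SharpMainTerm` (S♯) and `oneFlatFactor : OneFlatFactor` (S1) from the four landed stubs
(`stub_sieveCount`, `stub_singularTail`, `stub_primeClassSums`, `stub_primeSieve`), and the EXACT REDUCTION
**`twoFlatFactors_iff_dimOne : TwoFlatFactors ↔ DimOne`**: the crux (Green–Tao Conj. 1.2 at `d = 1`,
shift-uniform Dickson–Hardy–Littlewood with von Mangoldt weights) is equivalent to the constant-free statement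
that correlations with at least two rough factors `Λ♭_N = Λ − Λ_{ℤ/P_N}` along a non-degenerate `d = 1` system
are `o(N)` (at `t = 2`, `(n, n+2)`: `Σ_{n ≤ N} Λ♭_N(n)Λ♭_N(n+2) = o(N)`). Zero slack: the registered stub
`stub_twoFlatFactors` IS the crux; every catalogued binary barrier (Selberg parity, Siegel zero,
circle-method `L²`) bites there and only there. Two consequences recorded for the disprover:
`generalizedHardyLittlewood_of_twoFlatFactors` (the sub-problem from S2 alone, via the route's proved
`Assembly_holds`) and `twoFlatFactors_false_of_unboundedSiegelZeros` — S2 is Landau–Siegel-complete: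
modulo the vendored theorem of Matomäki–Merikoski, Siegel zeros of unbounded quality refute it (the witness
family `(n, n + 2q)` of `PairsToGHL.Negative.not_generalizedHardyLittlewood_of_unboundedSiegelZeros`).

References: B. Green, T. Tao, Ann. of Math. 171 (2010), Conj. 1.2, (1.5), §12 (12.3) [GreenTao2010];
K. Matomäki, J. Merikoski, *Siegel zeros, twin primes, Goldbach's conjecture, and primes in short intervals*,
IMRN (2023), Thm. 1.3 [MatomakiMerikoski2023].
-/

noncomputable section

namespace Summit.Parity.GeneralizedHardyLittlewood.Cruxes.DimOne.BirthSieve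

open scoped BigOperators Classical
open Finset Filter MeasureTheory Literature.NumberTheory.Sieve
open Summit.Parity.GeneralizedHardyLittlewood.Theses.DicksonFibration (DimOne)

variable {t : ℕ}

/-! ## The multilinear expansion (as in the registrar's birth skeleton) -/

/-- The multilinear expansion of the crux's summand over the set `T` of rough positions. [folklore] -/
theorem prod_intVonMangoldt_eq (Ψ : Fin t → AffLinForm 1) (N : ℕ) (n : Fin 1 → ℤ) :
    ∏ i, intVonMangoldt ((Ψ i).eval n) =
      ∑ T ∈ (univ : Finset (Fin t)).powerset,
        (∏ i ∈ T, flatZ N ((Ψ i).eval n)) * ∏ i ∈ univ \ T, sharpZ N ((Ψ i).eval n) := by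
  calc ∏ i, intVonMangoldt ((Ψ i).eval n)
      = ∏ i, (flatZ N ((Ψ i).eval n) + sharpZ N ((Ψ i).eval n)) :=
        Finset.prod_congr rfl fun i _ => intVonMangoldt_eq_flatZ_add_sharpZ N _
    _ = _ := Finset.prod_add _ _ _

/-- `vonMangoldtSum Ψ K N = Σ_{T ⊆ [t]} C_T`. [folklore] -/
theorem vonMangoldtSum_eq_sum_corrTerm (Ψ : Fin t → AffLinForm 1) (K : Set (Fin 1 → ℝ)) (N : ℕ) :
    vonMangoldtSum Ψ K N = ∑ T ∈ (univ : Finset (Fin t)).powerset, corrTerm T Ψ K N := by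
  unfold vonMangoldtSum corrTerm
  rw [Finset.sum_comm]
  exact Finset.sum_congr rfl fun n _ => prod_intVonMangoldt_eq Ψ N n

/-- Splitting a sum over the power set by cardinality `0`, `1`, `≥ 2`. [folklore] -/
theorem sum_powerset_split (c : Finset (Fin t) → ℝ) :
    ∑ T ∈ (univ : Finset (Fin t)).powerset, c T =
      c ∅ + ∑ i : Fin t, c {i} +
        ∑ T ∈ (univ : Finset (Fin t)).powerset.filter (fun T => 2 ≤ T.card), c T := by
  rw [← Finset.sum_filter_add_sum_filter_not (univ : Finset (Fin t)).powerset
    (fun T => 2 ≤ T.card) c]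
  have hset : (univ : Finset (Fin t)).powerset.filter (fun T => ¬ 2 ≤ T.card) =
      insert ∅ ((univ : Finset (Fin t)).map
        ⟨fun i : Fin t => ({i} : Finset (Fin t)), Finset.singleton_injective⟩) := by
    ext T
    simp only [Finset.mem_filter, Finset.mem_powerset, Finset.subset_univ, true_and,
      Finset.mem_insert, Finset.mem_map, Finset.mem_univ, Function.Embedding.coeFn_mk, not_le]
    constructor
    · intro hT
      rcases Nat.lt_or_ge T.card 1 with h0 | h1
      · left
        exact Finset.card_eq_zero.mp (by omega)
      · right
        have hc : T.card = 1 := by omega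
        obtain ⟨a, ha⟩ := Finset.card_eq_one.mp hc
        exact ⟨a, ha.symm⟩
    · rintro (rfl | ⟨a, rfl⟩)
      · simp
      · simp
  have hnotin : (∅ : Finset (Fin t)) ∉ (univ : Finset (Fin t)).map
      ⟨fun i : Fin t => ({i} : Finset (Fin t)), Finset.singleton_injective⟩ := by
    simp
  rw [hset, Finset.sum_insert hnotin, Finset.sum_map]
  simp only [Function.Embedding.coeFn_mk]
  ring

/-! ## The composition: the five stubs imply the crux, by name -/

/-- **Three-piece composition** `S♯ → S1 → S2 → DimOne` (the registrar's `DimOne_of`, verbatim up to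
the model): `vonMangoldtSum = C_∅ + Σ_i C_{{i}} + Σ_{|T| ≥ 2} C_T`, S♯ at `ε/3`, S1 at `ε/(3t)`, S2 at `ε/3`.
[folklore] -/
theorem dimOne_of_three :
    SharpMainTerm → OneFlatFactor → TwoFlatFactors →
      Summit.Parity.GeneralizedHardyLittlewood.Theses.DicksonFibration.DimOne := by
  intro hS hO hM t L ht ε hε
  have htpos : (0 : ℝ) < (t : ℝ) := by exact_mod_cast ht
  obtain ⟨N₁, hN₁⟩ := hS t L ht (ε / 3) (by positivity)
  obtain ⟨N₂, hN₂⟩ := hO t L ht (ε / (3 * t)) (by positivity)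
  obtain ⟨N₃, hN₃⟩ := hM t L ht (ε / 3) (by positivity)
  refine ⟨max N₁ (max N₂ N₃), fun N hN Ψ hΨ hL K hK hKN => ?_⟩
  have hN1 : N₁ ≤ N := le_trans (le_max_left _ _) hN
  have hN2 : N₂ ≤ N := le_trans (le_trans (le_max_left _ _) (le_max_right _ _)) hN
  have hN3 : N₃ ≤ N := le_trans (le_trans (le_max_right _ _) (le_max_right _ _)) hN
  have h1 := hN₁ N hN1 Ψ hΨ hL K hK hKN
  have h2 := hN₂ N hN2 Ψ hΨ hL K hK hKN
  have h3 := hN₃ N hN3 Ψ hΨ hL K hK hKN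
  have hsing : |∑ i : Fin t, corrTerm {i} Ψ K N| ≤ ε / 3 * (N : ℝ) := by
    calc |∑ i : Fin t, corrTerm {i} Ψ K N|
        ≤ ∑ i : Fin t, |corrTerm {i} Ψ K N| := Finset.abs_sum_le_sum_abs _ _
      _ ≤ ∑ i : Fin t, ε / (3 * t) * (N : ℝ) := Finset.sum_le_sum fun i _ => h2 i
      _ = ε / 3 * (N : ℝ) := by
          rw [Finset.sum_const, Finset.card_univ, Fintype.card_fin, nsmul_eq_mul]
          field_simp
  have key : vonMangoldtSum Ψ K N - archFactor Ψ K * singularProduct Ψ =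
      (corrTerm ∅ Ψ K N - archFactor Ψ K * singularProduct Ψ) +
        ∑ i : Fin t, corrTerm {i} Ψ K N +
        ∑ T ∈ (univ : Finset (Fin t)).powerset.filter (fun T => 2 ≤ T.card), corrTerm T Ψ K N := by
    rw [vonMangoldtSum_eq_sum_corrTerm, sum_powerset_split]
    ring
  rw [key]
  calc |(corrTerm ∅ Ψ K N - archFactor Ψ K * singularProduct Ψ) +
        ∑ i : Fin t, corrTerm {i} Ψ K N +
        ∑ T ∈ (univ : Finset (Fin t)).powerset.filter (fun T => 2 ≤ T.card), corrTerm T Ψ K N|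
      ≤ |corrTerm ∅ Ψ K N - archFactor Ψ K * singularProduct Ψ| +
          |∑ i : Fin t, corrTerm {i} Ψ K N| +
          |∑ T ∈ (univ : Finset (Fin t)).powerset.filter (fun T => 2 ≤ T.card), corrTerm T Ψ K N| :=
        abs_add_three _ _ _
    _ ≤ ε / 3 * (N : ℝ) + ε / 3 * (N : ℝ) + ε / 3 * (N : ℝ) := add_le_add_three h1 hsing h3
    _ = ε * (N : ℝ) := by ring

/-- **THE SKELETON THEOREM.** The five registered stubs imply
`Summit.Parity.GeneralizedHardyLittlewood.Theses.DicksonFibration.DimOne`, a real proof (no `sorry`):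
S♯ from `SieveCount ∧ SingularTailAtLevel`, S1 from `SieveCount ∧ (PrimeClassSums → PrimeSieveMain)`,
then the three-piece composition. Every stub is consumed. [folklore] -/
theorem DimOne_of :
    SieveCount → SingularTailAtLevel → PrimeClassSums → PrimeSieve → TwoFlatFactors →
      Summit.Parity.GeneralizedHardyLittlewood.Theses.DicksonFibration.DimOne :=
  fun hA hB hC2 hC1 hD =>
    dimOne_of_three (sharpMainTerm_of hA hB) (oneFlatFactor_of hA (hC1 hC2)) hD


/-! ## S♯, S1 and the exact reduction of the crux to `TwoFlatFactors` -/

/-- **S♯ holds** (the sharp main term of the sieve model, uniform in the shifts): from the landed stubs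
`stub_sieveCount` and `stub_singularTail`. [cite: GreenTao2010, Conj. 1.2] -/
theorem sharpMainTerm : SharpMainTerm :=
  sharpMainTerm_of stub_sieveCount stub_singularTail

/-- **S1 holds** (one rough factor is negligible): from the landed stubs `stub_sieveCount`,
`stub_primeClassSums`, `stub_primeSieve`. [cite: GreenTao2010, Conj. 1.2] -/
theorem oneFlatFactor : OneFlatFactor :=
  oneFlatFactor_of stub_sieveCount (stub_primeSieve stub_primeClassSums)

/-- **The crux from the two-rough-factor statement**: `TwoFlatFactors → DimOne`. [folklore] -/
theorem dimOne_of_twoFlatFactors : TwoFlatFactors → DimOne :=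
  fun h => dimOne_of_three sharpMainTerm oneFlatFactor h

/-- **The two-rough-factor statement from the crux**: `DimOne → TwoFlatFactors`
(`Σ_{#T ≥ 2} C_T = (vonMangoldtSum − β_∞𝔖) − (C_∅ − β_∞𝔖) − Σ_i C_{{i}}`, each piece `≤ εN/3`). [folklore] -/
theorem twoFlatFactors_of_dimOne : DimOne → TwoFlatFactors := by
  intro hD t L ht ε hε
  have htpos : (0 : ℝ) < (t : ℝ) := by exact_mod_cast ht
  obtain ⟨N₁, hN₁⟩ := hD t L ht (ε / 3) (by positivity)
  obtain ⟨N₂, hN₂⟩ := sharpMainTerm t L ht (ε / 3) (by positivity)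
  obtain ⟨N₃, hN₃⟩ := oneFlatFactor t L ht (ε / (3 * t)) (by positivity)
  refine ⟨max N₁ (max N₂ N₃), fun N hN Ψ hΨ hL K hK hKN => ?_⟩
  have hN1 : N₁ ≤ N := le_trans (le_max_left _ _) hN
  have hN2 : N₂ ≤ N := le_trans (le_trans (le_max_left _ _) (le_max_right _ _)) hN
  have hN3 : N₃ ≤ N := le_trans (le_trans (le_max_right _ _) (le_max_right _ _)) hN
  have h1 := hN₁ N hN1 Ψ hΨ hL K hK hKN
  have h2 := hN₂ N hN2 Ψ hΨ hL K hK hKN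
  have h3 := hN₃ N hN3 Ψ hΨ hL K hK hKN
  have hsing : |∑ i : Fin t, corrTerm {i} Ψ K N| ≤ ε / 3 * (N : ℝ) := by
    calc |∑ i : Fin t, corrTerm {i} Ψ K N|
        ≤ ∑ i : Fin t, |corrTerm {i} Ψ K N| := Finset.abs_sum_le_sum_abs _ _
      _ ≤ ∑ i : Fin t, ε / (3 * t) * (N : ℝ) := Finset.sum_le_sum fun i _ => h3 i
      _ = ε / 3 * (N : ℝ) := by
          rw [Finset.sum_const, Finset.card_univ, Fintype.card_fin, nsmul_eq_mul]
          field_simp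
  have key : ∑ T ∈ (univ : Finset (Fin t)).powerset.filter (fun T => 2 ≤ T.card), corrTerm T Ψ K N =
      (vonMangoldtSum Ψ K N - archFactor Ψ K * singularProduct Ψ) -
        (corrTerm ∅ Ψ K N - archFactor Ψ K * singularProduct Ψ) - ∑ i : Fin t, corrTerm {i} Ψ K N := by
    rw [vonMangoldtSum_eq_sum_corrTerm, sum_powerset_split]
    ring
  rw [key]
  calc |(vonMangoldtSum Ψ K N - archFactor Ψ K * singularProduct Ψ) -
        (corrTerm ∅ Ψ K N - archFactor Ψ K * singularProduct Ψ) - ∑ i : Fin t, corrTerm {i} Ψ K N|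
      ≤ |vonMangoldtSum Ψ K N - archFactor Ψ K * singularProduct Ψ| +
          |corrTerm ∅ Ψ K N - archFactor Ψ K * singularProduct Ψ| + |∑ i : Fin t, corrTerm {i} Ψ K N| := by
        have := abs_sub (vonMangoldtSum Ψ K N - archFactor Ψ K * singularProduct Ψ -
          (corrTerm ∅ Ψ K N - archFactor Ψ K * singularProduct Ψ)) (∑ i : Fin t, corrTerm {i} Ψ K N)
        have := abs_sub (vonMangoldtSum Ψ K N - archFactor Ψ K * singularProduct Ψ)
          (corrTerm ∅ Ψ K N - archFactor Ψ K * singularProduct Ψ)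
        linarith
    _ ≤ ε / 3 * (N : ℝ) + ε / 3 * (N : ℝ) + ε / 3 * (N : ℝ) := add_le_add_three h1 h2 hsing
    _ = ε * (N : ℝ) := by ring

/-- **THE EXACT REDUCTION.** The crux `DimOne` (Dickson–Hardy–Littlewood at `d = 1`, all `t`, uniform in
the shifts) is EQUIVALENT to `TwoFlatFactors`: the correlations of a non-degenerate one-dimensional system
carrying at least two rough factors `Λ♭_N = Λ − Λ_{ℤ/P_N}` are `o(N)`. (Registered sub-goal
`twoFlatFactors_iff_dimOne` of stmt-Parity-0819; the forward direction is the skeleton's composition with the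
landed stubs, the backward direction subtracts the two proved pieces from the crux.) [folklore] -/
theorem twoFlatFactors_iff_dimOne : TwoFlatFactors ↔ Summit.Parity.GeneralizedHardyLittlewood.Theses.DicksonFibration.DimOne :=
  ⟨dimOne_of_twoFlatFactors, twoFlatFactors_of_dimOne⟩

/-! ## Consequences recorded for the disprover -/

/-- **The sub-problem from S2 alone**: `TwoFlatFactors → GeneralizedHardyLittlewood`, via the exact reduction
and the route's proved fibration lemma `Assembly_holds : DimOne → GeneralizedHardyLittlewood`.
[cite: GreenTao2010, Conj. 1.2] -/
theorem generalizedHardyLittlewood_of_twoFlatFactors : TwoFlatFactors → _root_.GeneralizedHardyLittlewood :=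
  fun h => Summit.Parity.GeneralizedHardyLittlewood.Theses.DicksonFibration.Assembly_holds
    (dimOne_of_twoFlatFactors h)

/-- **S2 is Landau–Siegel-complete**: modulo the vendored theorem of Matomäki–Merikoski
(`MatomakiMerikoski2023_pairCorrelation`, Thm. 1.3), Siegel zeros of unbounded quality refute
`TwoFlatFactors` (the witness family `(n, n + 2q)`, `N = q^{10}`, `L = 3` of
`PairsToGHL.Negative.not_generalizedHardyLittlewood_of_unboundedSiegelZeros`, transported through
`generalizedHardyLittlewood_of_twoFlatFactors`). So any proof of the open stub bounds the quality of
exceptional zeros. [cite: MatomakiMerikoski2023, Theorem 1.3] -/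
theorem twoFlatFactors_false_of_unboundedSiegelZeros
    (hMM : Literature.Barriers.Parity.MatomakiMerikoski2023_pairCorrelation)
    (hU : Literature.Barriers.Parity.UnboundedSiegelZeros) : ¬ TwoFlatFactors :=
  fun h => Summit.Parity.GeneralizedHardyLittlewood.Theorems.PairsToGHL.Negative.not_generalizedHardyLittlewood_of_unboundedSiegelZeros
    hMM hU (generalizedHardyLittlewood_of_twoFlatFactors h)

end Summit.Parity.GeneralizedHardyLittlewood.Cruxes.DimOne.BirthSieve

end
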